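import Mathlib.Analysis.Calculus.MeanValue
import Mathlib.Analysis.Calculus.UniformLimitsDeriv
import Literature.Analysis.Calculus.DerivativeInterpolation
import Literature.Analysis.FluidPDE.ClassicalSolutionRescale
import Literature.Analysis.FluidPDE.HolderExtraction
import HarnessLib

/-!
# Quasi-steady core sequences (frozen-core variables of Type II bubbling) for Navier–Stokes

Analysis/FluidPDE definition file, wanted by route `NavierStokesRegularity/GaldiLiouvilleGate`
(support item `FrozenCoreSteadyLimit`, stmt-0925; second home: `NoTypeII`, route `TypeILiouville`)
to give a Lean signature to the "modulated quasi-steady core" hypothesis of a frozen-core /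
bubbling analysis of a putative finite-time singularity at FIXED viscosity `ν`.

Let `u : ℝ → E → E` be a velocity field (time first; `E = ℝ³` in the application), and let
`(t_k, ξ_k, λ_k)` be core times, centres and scales. The **core profiles** are the parabolic zooms
`V_k(s, y) := λ_k u(t_k + λ_k² s, ξ_k + λ_k y)` (`coreProfile u (t k) (ξ k) (lam k)`), the
rescaled solutions `v^{(k)}` of Koch–Nadirashvili–Seregin–Šverák 2009, §6, (6.2), with `λ_k = M_k⁻¹`
there; in the tree's vocabulary `λ • stPull (λ²) λ t₀ ξ₀ u` (definitionally), equivalently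
`nsRescale λ` of the `(t₀, ξ₀)`-translate (`coreProfile_eq_nsRescale`), so that classical solutions
transfer to their core profiles at the same viscosity (`IsClassicalNSSolutionOn.coreProfile`,
from the accepted `IsClassicalNSSolutionOn.nsRescale_translate_zero`).

* `IsQuasiSteadyCoreSequence ν T u t ξ lam M` packages: (0) `0 ≤ t_k < T`, `t_k → T`,
  `0 < λ_k → 0`, and every backward window fits (`∀ A > 0`, eventually `λ_k² A ≤ t_k`);
  (a) UNIFORM `C³` BOUNDS ON PARABOLIC CORE WINDOWS `[-A, 0] × B̄(0, A)` (genuine smoothness: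
  `ContDiffAt` of the space–time field at every point of the window, so that the time derivative and
  the iterated space derivatives below are the true ones) with `‖D_yⁿ V_k‖ ≤ C_A`, `n ≤ 3`, for all
  large `k`; (b) EXPLICIT QUASI-STEADINESS `sup_{[-A,0]×B̄_A} ‖∂_s V_k‖ → 0`; (c) the NORMALISATION
  `λ_k ‖u(t_k, ξ_k)‖ = 1` (i.e. `‖V_k(0, 0)‖ = 1`, KNSS (6.3)); (d) BOUNDED CORE REYNOLDS NUMBER
  `λ_k sup_x ‖u(t_k, x)‖ ≤ M ν` (so `‖V_k(0, ·)‖ ≤ M ν`).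
* `HasBoundedDirichletShare u t lam`: `sup_k λ_k ∫ |∇u(t_k, x)|² dx < ∞` — in dimension three exactly
  `sup_k ∫ |∇_y V_k(0, y)|² dy < ∞` (`lintegral_frobeniusNormSq_fderiv_coreProfile_zero`,
  `hasBoundedDirichletShare_iff_core`), the hypothesis under which a steady core limit has finite
  Dirichlet integral.

Why (b) is an explicit field (refuters' finding on stmt-0925): snapshot modulation plus a Type II
rate control `(λ²)˙` only in time average; without (b) a zoom limit is merely a bounded ANCIENT
solution (`IsKNSSBlowupLimit` territory), not a steady one.

This is a DEFINITION file: no claim about blow-up enters the Literature. An honest inhabitant of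
`IsQuasiSteadyCoreSequence` for a Leray–Hopf solution would be an actual (Type II, bounded core
Reynolds number) singularity, whose existence is open; the API below is bookkeeping:
scaling/translation covariance, `1 ≤ M ν`, `‖V_k(0,0)‖ = 1`, `‖V_k(0,y)‖ ≤ M ν`, the windows lie in
the zoomed time interval, the Dirichlet scaling identity, and the COMPACTNESS STEP of a frozen-core
argument (`IsQuasiSteadyCoreSequence.exists_strictMono_tendstoUniformlyOn`): along a subsequence the
slices `V_k(0, ·)` converge in `C²_loc` to a `C²` field `U` with `‖U 0‖ = 1`, `‖U‖ ≤ M ν`, and by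
(b) the space–time fields converge on every window to the `s`-independent field `(s, y) ↦ U y`
(Arzelà–Ascoli on balls along one diagonal subsequence, the tree's
`exists_strictMono_tendstoUniformlyOn_of_bound`; Landau's interpolation inequality, the tree's
`Calculus.norm_fderiv_le_of_norm_le_of_lipschitz`, upgrades uniform convergence to the first two
derivatives; Mathlib's `hasFDerivAt_of_tendstoUniformlyOnFilter` identifies the limits). Passing to
the limit in the Navier–Stokes equation (the steady system for `U`) is left to the user of the
definition (route item stmt-0925).

The frozen-core picture (Type II cores as quasi-static rescaled steady states) is the paradigm of
Matano–Merle (Comm. Pure Appl. Math. 57 (2004)) for the supercritical semilinear heat equation; for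
Navier–Stokes the zoom variables are those of KNSS 2009, §6, where (without (b)) they produce bounded
ancient mild solutions (Prop. 6.1; in the tree `KNSS2009_blowup_generates_ancient`).

## References

* G. Koch, N. Nadirashvili, G. Seregin, V. Šverák, *Liouville theorems for the Navier–Stokes
  equations and applications*, Acta Math. 203 (2009) = arXiv:0709.3599, §6, (6.2)–(6.3), Prop. 6.1
  (p. 11). [KochNadirashviliSereginSverak2009]
* H. Matano, F. Merle, *On nonexistence of type II blowup for a supercritical nonlinear heat
  equation*, Comm. Pure Appl. Math. 57 (2004), 1494–1541 (quasi-static rescaled steady states).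
-/

noncomputable section

open Set Function Filter Metric MeasureTheory Topology
open scoped ENNReal NNReal ContDiff

namespace Literature.Analysis.FluidPDE

/-! ### Core profiles -/

section Core

variable {E : Type*} [NormedAddCommGroup E] [InnerProductSpace ℝ E]
variable {F : Type*} [NormedAddCommGroup F] [NormedSpace ℝ F]

/-- The **core profile** (parabolic zoom) of a space–time field `u` (time first) at the space–time
point `(t₀, x₀)` with scale `c`: `coreProfile u t₀ x₀ c s y = c • u (t₀ + c² s) (x₀ + c y)` —
the Navier–Stokes scaling at fixed viscosity composed with the translation to `(t₀, x₀)`; these are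
the rescaled solutions `v^{(k)}(y, s) = M_k⁻¹ u(x_k + y/M_k, t_k + s/M_k²)` of KNSS 2009, (6.2)
(`c = M_k⁻¹`). Definitionally `c • stPull (c ^ 2) c t₀ x₀ u`. [cite: KochNadirashviliSereginSverak2009, §6 (6.2)] -/
def coreProfile (u : ℝ → E → F) (t₀ : ℝ) (x₀ : E) (c : ℝ) : ℝ → E → F :=
  c • stPull (c ^ 2) c t₀ x₀ u

/-- The **core pressure** accompanying `coreProfile`: `corePressure p t₀ x₀ c s y =
c² p (t₀ + c² s) (x₀ + c y)` (KNSS 2009, (6.2); Caffarelli–Kohn–Nirenberg 1982, (1.6)).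
Definitionally `c ^ 2 • stPull (c ^ 2) c t₀ x₀ p`. [cite: KochNadirashviliSereginSverak2009, §6 (6.2)] -/
def corePressure (p : ℝ → E → ℝ) (t₀ : ℝ) (x₀ : E) (c : ℝ) : ℝ → E → ℝ :=
  c ^ 2 • stPull (c ^ 2) c t₀ x₀ p

/-- Unfolding `coreProfile`. [folklore] -/
@[simp]
theorem coreProfile_apply (u : ℝ → E → F) (t₀ : ℝ) (x₀ : E) (c s : ℝ) (y : E) :
    coreProfile u t₀ x₀ c s y = c • u (t₀ + c ^ 2 * s) (x₀ + c • y) :=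
  rfl

/-- Unfolding `corePressure`. [folklore] -/
@[simp]
theorem corePressure_apply (p : ℝ → E → ℝ) (t₀ : ℝ) (x₀ : E) (c s : ℝ) (y : E) :
    corePressure p t₀ x₀ c s y = c ^ 2 * p (t₀ + c ^ 2 * s) (x₀ + c • y) :=
  rfl

/-- `coreProfile` in the tree's space–time rescaling vocabulary (definitional). [folklore] -/
theorem coreProfile_eq_smul_stPull (u : ℝ → E → F) (t₀ : ℝ) (x₀ : E) (c : ℝ) :
    coreProfile u t₀ x₀ c = c • stPull (c ^ 2) c t₀ x₀ u :=
  rfl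

/-- `corePressure` in the tree's space–time rescaling vocabulary (definitional). [folklore] -/
theorem corePressure_eq_smul_stPull (p : ℝ → E → ℝ) (t₀ : ℝ) (x₀ : E) (c : ℝ) :
    corePressure p t₀ x₀ c = c ^ 2 • stPull (c ^ 2) c t₀ x₀ p :=
  rfl

/-- The core profile is the Navier–Stokes rescaling `nsRescale c` (Leray's scaling at fixed
viscosity, `SelfSimilar`) of the translate `u (t₀ + ·) (x₀ + ·)` (definitional). [folklore] -/
theorem coreProfile_eq_nsRescale (u : ℝ → E → F) (t₀ : ℝ) (x₀ : E) (c : ℝ) :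
    coreProfile u t₀ x₀ c = nsRescale c (fun t x => u (t₀ + t) (x₀ + x)) :=
  rfl

/-- The core pressure is `nsRescalePressure c` of the translated pressure (definitional). [folklore] -/
theorem corePressure_eq_nsRescalePressure (p : ℝ → E → ℝ) (t₀ : ℝ) (x₀ : E) (c : ℝ) :
    corePressure p t₀ x₀ c = nsRescalePressure c (fun t x => p (t₀ + t) (x₀ + x)) :=
  rfl

/-- The final-time slice of the core profile: `V(0, y) = c • u (t₀) (x₀ + c y)`. [folklore] -/
theorem coreProfile_zero (u : ℝ → E → F) (t₀ : ℝ) (x₀ : E) (c : ℝ) :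
    coreProfile u t₀ x₀ c 0 = fun y => c • u t₀ (x₀ + c • y) := by
  funext y
  simp

/-- The core profile at the core point: `V(0, 0) = c • u t₀ x₀` (KNSS 2009, (6.3):
`|v^{(k)}(0,0)| = 1` for `c = M_k⁻¹ = |u(x_k,t_k)|⁻¹`). [cite: KochNadirashviliSereginSverak2009, §6 (6.3)] -/
theorem coreProfile_zero_zero (u : ℝ → E → F) (t₀ : ℝ) (x₀ : E) (c : ℝ) :
    coreProfile u t₀ x₀ c 0 0 = c • u t₀ x₀ := by
  simp

/-- Norm of the final-time slice: `‖V(0, y)‖ = c ‖u(t₀, x₀ + c y)‖` for `0 ≤ c`. [folklore] -/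
theorem norm_coreProfile_zero (u : ℝ → E → F) (t₀ : ℝ) (x₀ : E) {c : ℝ} (hc : 0 ≤ c) (y : E) :
    ‖coreProfile u t₀ x₀ c 0 y‖ = c * ‖u t₀ (x₀ + c • y)‖ := by
  rw [coreProfile_zero, norm_smul, Real.norm_of_nonneg hc]

/-- Scale `1` at the origin of space–time is the identity. [folklore] -/
@[simp]
theorem coreProfile_zero_zero_one (u : ℝ → E → F) : coreProfile u 0 0 1 = u := by
  funext s y
  simp

/-- The affine time change of the zoom maps the zoomed window onto `[0, T)`:
`{s | t₀ + c² s ∈ [0, T)} = [-t₀/c², (T - t₀)/c²)` for `c ≠ 0`. [folklore] -/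
theorem preimage_coreTime_Ico {c : ℝ} (hc : c ≠ 0) (t₀ T : ℝ) :
    (fun r => t₀ + c ^ 2 * r) ⁻¹' Ico 0 T = Ico (-(t₀ / c ^ 2)) ((T - t₀) / c ^ 2) := by
  have hc2 : 0 < c ^ 2 := by positivity
  ext r
  simp only [mem_preimage, mem_Ico, neg_le, le_div_iff₀ hc2, lt_div_iff₀ hc2]
  constructor
  · rintro ⟨h1, h2⟩
    exact ⟨by linarith, by linarith⟩
  · rintro ⟨h1, h2⟩
    exact ⟨by linarith, by linarith⟩

/-- A backward window `[-A, 0]` lies in the open zoomed interval `(-t₀/c², (T - t₀)/c²)` as soon as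
`c² (A + 1) ≤ t₀ < T` (`c ≠ 0`). [folklore] -/
theorem Icc_subset_Ioo_coreTime {c A t₀ T : ℝ} (hc : c ≠ 0) (hA : c ^ 2 * (A + 1) ≤ t₀)
    (hT : t₀ < T) : Icc (-A) 0 ⊆ Ioo (-(t₀ / c ^ 2)) ((T - t₀) / c ^ 2) := by
  have hc2 : 0 < c ^ 2 := by positivity
  intro s hs
  rw [mem_Ioo, neg_lt, lt_div_iff₀ hc2, lt_div_iff₀ hc2]
  constructor
  · have : -s * c ^ 2 ≤ A * c ^ 2 := by nlinarith [hs.1]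
    nlinarith
  · nlinarith [hs.2]

variable [FiniteDimensional ℝ E]

/-- **Classical solutions transfer to their core profiles at the same viscosity** (Leray's
scaling composed with a space–time translation; KNSS 2009, (6.2): "`v^{(k)}` are mild solutions of
the Navier–Stokes equations in `ℝⁿ × (A_k, 0)`"): if `(u, p)` is a classical solution of the
unforced system with viscosity `ν` on the time set `S`, then `(coreProfile u t₀ x₀ c,
corePressure p t₀ x₀ c)` is a classical solution of the unforced system with the SAME viscosity on
`{s | t₀ + c² s ∈ S}`, `0 < c` (the accepted `IsClassicalNSSolutionOn.nsRescale_translate_zero`). [cite: KochNadirashviliSereginSverak2009, §6 (6.2)] -/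
theorem IsClassicalNSSolutionOn.coreProfile {S : Set ℝ} {ν : ℝ} {u : ℝ → E → E} {p : ℝ → E → ℝ}
    (h : IsClassicalNSSolutionOn S ν 0 u p) {c : ℝ} (hc : 0 < c) (t₀ : ℝ) (x₀ : E) :
    IsClassicalNSSolutionOn ((fun r => t₀ + c ^ 2 * r) ⁻¹' S) ν 0 (coreProfile u t₀ x₀ c)
      (corePressure p t₀ x₀ c) :=
  h.nsRescale_translate_zero hc t₀ x₀

/-- The same on `[0, T)`: the core profile of a classical solution on `[0, T) × E` is a classical
solution on `[-t₀/c², (T - t₀)/c²) × E`. [cite: KochNadirashviliSereginSverak2009, §6 (6.2)] -/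
theorem IsClassicalNSSolutionOn.coreProfile_Ico {T ν : ℝ} {u : ℝ → E → E} {p : ℝ → E → ℝ}
    (h : IsClassicalNSSolutionOn (Ico 0 T) ν 0 u p) {c : ℝ} (hc : 0 < c) (t₀ : ℝ) (x₀ : E) :
    IsClassicalNSSolutionOn (Ico (-(t₀ / c ^ 2)) ((T - t₀) / c ^ 2)) ν 0
      (FluidPDE.coreProfile u t₀ x₀ c) (corePressure p t₀ x₀ c) := by
  rw [← preimage_coreTime_Ico hc.ne']
  exact h.coreProfile hc t₀ x₀

/-- And on the OPEN zoomed interval `(-t₀/c², (T - t₀)/c²)`, where the one-sided time derivative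
of `IsClassicalNSSolutionOn` is the two-sided one. [cite: KochNadirashviliSereginSverak2009, §6 (6.2)] -/
theorem IsClassicalNSSolutionOn.coreProfile_Ioo {T ν : ℝ} {u : ℝ → E → E} {p : ℝ → E → ℝ}
    (h : IsClassicalNSSolutionOn (Ico 0 T) ν 0 u p) {c : ℝ} (hc : 0 < c) (t₀ : ℝ) (x₀ : E) :
    IsClassicalNSSolutionOn (Ioo (-(t₀ / c ^ 2)) ((T - t₀) / c ^ 2)) ν 0
      (FluidPDE.coreProfile u t₀ x₀ c) (corePressure p t₀ x₀ c) :=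
  (h.coreProfile_Ico hc t₀ x₀).mono Ioo_subset_Ico_self (uniqueDiffOn_Ioo _ _)

end Core

/-! ### Quasi-steady core sequences -/

section QuasiSteady

variable {E : Type*} [NormedAddCommGroup E] [InnerProductSpace ℝ E]

/-- **Quasi-steady core sequence** (the "modulated quasi-steady core" hypothesis of a frozen-core
analysis of a putative singularity at time `T`, at FIXED viscosity `ν`). For a velocity field
`u : ℝ → E → E` on `[0, T) × E`, core times `t : ℕ → ℝ`, centres `ξ : ℕ → E`, scales `lam : ℕ → ℝ`
and a constant `M`, with core profiles `V_k = coreProfile u (t k) (ξ k) (lam k)`, i.e.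
`V_k(s, y) = λ_k u(t_k + λ_k² s, ξ_k + λ_k y)` (KNSS 2009, (6.2)):
(0) `0 ≤ t_k < T`, `t_k → T`, `0 < λ_k → 0`, and for every `A > 0` eventually `λ_k² A ≤ t_k` (the
backward windows fit into `[0, T)`);
(a) uniform `C³` bounds on the parabolic core windows: for every `A > 0` there is `C_A` such that for
all large `k`, the space–time field `V_k` is `C³` at every point of `[-A, 0] × B̄(0, A)` and
`‖V_k‖, ‖D_y V_k‖, ‖D_y² V_k‖, ‖D_y³ V_k‖ ≤ C_A` there;
(b) quasi-steadiness: for every `A > 0`, `sup_{[-A,0] × B̄(0,A)} ‖∂_s V_k‖ → 0` as `k → ∞`;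
(c) normalisation `λ_k ‖u(t_k, ξ_k)‖ = 1`, i.e. `‖V_k(0, 0)‖ = 1` (KNSS 2009, (6.3));
(d) bounded core Reynolds number `λ_k ‖u(t_k, x)‖ ≤ M ν` for all `x`, i.e. `‖V_k(0, ·)‖ ≤ M ν`.
A packaging of hypotheses requested by route `NavierStokesRegularity/GaldiLiouvilleGate`
(stmt-0925); no existence claim is made. [folklore] -/
structure IsQuasiSteadyCoreSequence (ν T : ℝ) (u : ℝ → E → E) (t : ℕ → ℝ) (ξ : ℕ → E)
    (lam : ℕ → ℝ) (M : ℝ) : Prop where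
  /-- (0a) the core times lie in `[0, T)` -/
  time_mem : ∀ k, t k ∈ Ico 0 T
  /-- (0b) the core times tend to `T` -/
  tendsto_time : Tendsto t atTop (𝓝 T)
  /-- (0c) the core scales are positive -/
  scale_pos : ∀ k, 0 < lam k
  /-- (0d) the core scales tend to `0` -/
  tendsto_scale : Tendsto lam atTop (𝓝 0)
  /-- (0e) every backward parabolic window fits: for `A > 0`, eventually `λ_k² A ≤ t_k`, so that the
  core times `t_k + λ_k² s`, `s ∈ [-A, 0]`, stay in `[0, T)` -/
  eventually_window : ∀ A : ℝ, 0 < A → ∀ᶠ k in atTop, lam k ^ 2 * A ≤ t k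
  /-- (a) uniform `C³` bounds on the parabolic core windows `[-A, 0] × B̄(0, A)`: genuine `C³`
  smoothness of the space–time field at each point of the window, and bounds on the field and its
  first three space derivatives, for all large `k` -/
  core_bound : ∀ A : ℝ, 0 < A → ∃ C : ℝ, ∀ᶠ k in atTop,
    ∀ s ∈ Icc (-A) 0, ∀ y ∈ closedBall (0 : E) A,
      ContDiffAt ℝ 3 (uncurry (coreProfile u (t k) (ξ k) (lam k))) (s, y) ∧
        ∀ n ≤ 3, ‖iteratedFDeriv ℝ n (coreProfile u (t k) (ξ k) (lam k) s) y‖ ≤ C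
  /-- (b) explicit quasi-steadiness: `sup_{[-A,0] × B̄(0,A)} ‖∂_s V_k‖ → 0` for every `A > 0` -/
  quasiSteady : ∀ A : ℝ, 0 < A → ∀ ε : ℝ, 0 < ε → ∀ᶠ k in atTop,
    ∀ s ∈ Icc (-A) 0, ∀ y ∈ closedBall (0 : E) A,
      ‖timeDeriv (coreProfile u (t k) (ξ k) (lam k)) s y‖ ≤ ε
  /-- (c) normalisation `λ_k ‖u(t_k, ξ_k)‖ = 1` (`‖V_k(0,0)‖ = 1`) -/
  scale_mul_norm_eq_one : ∀ k, lam k * ‖u (t k) (ξ k)‖ = 1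
  /-- (d) bounded core Reynolds number `λ_k sup_x ‖u(t_k, x)‖ ≤ M ν` -/
  scale_mul_norm_le : ∀ k x, lam k * ‖u (t k) x‖ ≤ M * ν

namespace IsQuasiSteadyCoreSequence

variable {ν T M : ℝ} {u : ℝ → E → E} {t : ℕ → ℝ} {ξ : ℕ → E} {lam : ℕ → ℝ}

/-- The normalisation in core variables: `‖V_k(0, 0)‖ = 1` (KNSS 2009, (6.3)). [cite: KochNadirashviliSereginSverak2009, §6 (6.3)] -/
theorem norm_coreProfile_zero_zero (h : IsQuasiSteadyCoreSequence ν T u t ξ lam M) (k : ℕ) :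
    ‖coreProfile u (t k) (ξ k) (lam k) 0 0‖ = 1 := by
  rw [coreProfile_zero_zero, norm_smul, Real.norm_of_nonneg (h.scale_pos k).le,
    h.scale_mul_norm_eq_one k]

/-- The core Reynolds bound in core variables: `‖V_k(0, y)‖ ≤ M ν` for all `y`. [folklore] -/
theorem norm_coreProfile_zero_le (h : IsQuasiSteadyCoreSequence ν T u t ξ lam M) (k : ℕ) (y : E) :
    ‖coreProfile u (t k) (ξ k) (lam k) 0 y‖ ≤ M * ν := by
  rw [norm_coreProfile_zero u (t k) (ξ k) (h.scale_pos k).le]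
  exact h.scale_mul_norm_le k _

/-- Consistency of (c) and (d): `1 ≤ M ν` (the normalised value is one of the bounded ones). [folklore] -/
theorem one_le_mul_viscosity (h : IsQuasiSteadyCoreSequence ν T u t ξ lam M) : 1 ≤ M * ν := by
  rw [← h.scale_mul_norm_eq_one 0]
  exact h.scale_mul_norm_le 0 (ξ 0)

/-- In particular `0 < M ν`. [folklore] -/
theorem mul_viscosity_pos (h : IsQuasiSteadyCoreSequence ν T u t ξ lam M) : 0 < M * ν :=
  one_pos.trans_le h.one_le_mul_viscosity

/-- The core values are nonzero at the core points: `u (t_k) (ξ_k) ≠ 0`. [folklore] -/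
theorem apply_ne_zero (h : IsQuasiSteadyCoreSequence ν T u t ξ lam M) (k : ℕ) : u (t k) (ξ k) ≠ 0 := by
  intro h0
  have := h.scale_mul_norm_eq_one k
  rw [h0, norm_zero, mul_zero] at this
  exact zero_ne_one this

/-- The core sup-norms blow up at least like `λ_k⁻¹`: `λ_k⁻¹ = ‖u(t_k, ξ_k)‖`. [folklore] -/
theorem norm_apply_eq_inv (h : IsQuasiSteadyCoreSequence ν T u t ξ lam M) (k : ℕ) :
    ‖u (t k) (ξ k)‖ = (lam k)⁻¹ := by
  have := h.scale_mul_norm_eq_one k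
  field_simp [(h.scale_pos k).ne'] at this ⊢
  linarith

/-- `0 < T`: the window condition with `A = 1` forces some `t_k > 0`, and `t_k < T`. [folklore] -/
theorem time_pos (h : IsQuasiSteadyCoreSequence ν T u t ξ lam M) : 0 < T := by
  obtain ⟨k, hk⟩ := (h.eventually_window 1 one_pos).exists
  have h1 : 0 < lam k ^ 2 * 1 := by have := h.scale_pos k; positivity
  exact (h1.trans_le hk).trans (h.time_mem k).2

/-- **The windows fit, strictly**: for every `A > 0`, eventually the backward window `[-A, 0]` lies
in the open zoomed interval `(-t_k/λ_k², (T - t_k)/λ_k²)` on which the core profile of a classical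
solution on `[0, T)` is a classical solution (`IsClassicalNSSolutionOn.coreProfile_Ioo`). [folklore] -/
theorem eventually_Icc_subset_Ioo (h : IsQuasiSteadyCoreSequence ν T u t ξ lam M) {A : ℝ}
    (hA : 0 < A) :
    ∀ᶠ k in atTop, Icc (-A) 0 ⊆ Ioo (-(t k / lam k ^ 2)) ((T - t k) / lam k ^ 2) := by
  filter_upwards [h.eventually_window (A + 1) (by linarith)] with k hk
  exact Icc_subset_Ioo_coreTime (h.scale_pos k).ne' hk (h.time_mem k).2

variable [FiniteDimensional ℝ E]

/-- **The core profiles of a classical solution are classical solutions on the windows**, at the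
same viscosity: for `(u, p)` classical on `[0, T) × E` (unforced), each `(V_k, Π_k)` is a classical
solution on `(-t_k/λ_k², (T - t_k)/λ_k²) × E`, an open interval eventually containing any `[-A, 0]`
(`eventually_Icc_subset_Ioo`). [cite: KochNadirashviliSereginSverak2009, §6 (6.2)] -/
theorem isClassicalNSSolutionOn_coreProfile (h : IsQuasiSteadyCoreSequence ν T u t ξ lam M)
    {p : ℝ → E → ℝ} (hu : IsClassicalNSSolutionOn (Ico 0 T) ν 0 u p) (k : ℕ) :
    IsClassicalNSSolutionOn (Ioo (-(t k / lam k ^ 2)) ((T - t k) / lam k ^ 2)) ν 0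
      (coreProfile u (t k) (ξ k) (lam k)) (corePressure p (t k) (ξ k) (lam k)) :=
  hu.coreProfile_Ioo (h.scale_pos k) (t k) (ξ k)

end IsQuasiSteadyCoreSequence

end QuasiSteady

/-! ### The Dirichlet share -/

section Dirichlet

variable {E : Type*} [NormedAddCommGroup E] [InnerProductSpace ℝ E] [FiniteDimensional ℝ E]
  [MeasurableSpace E] [BorelSpace E]

/-- **Bounded Dirichlet share** of the cores: `sup_k λ_k ∫ |∇u(t_k, x)|² dx < ∞`, rendered as
`∃ D, ∀ k, λ_k ∫⁻ |∇u(t_k)|² ≤ D` with the tree's Dirichlet density `frobeniusNormSq (fderiv ℝ (u t) x)`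
against Lebesgue measure. In dimension three `λ_k ∫ |∇u(t_k, x)|² dx = ∫ |∇_y V_k(0, y)|² dy`
(`hasBoundedDirichletShare_iff_core`), so this is the uniform bound on the Dirichlet integrals of the
core slices that makes a core limit a `D`-solution; it holds e.g. when `λ_k ≍ ν² / E(t_k)` for the
enstrophy `E`. Requested with `IsQuasiSteadyCoreSequence` by route `GaldiLiouvilleGate` (stmt-0925).
[folklore] -/
def HasBoundedDirichletShare (u : ℝ → E → E) (t : ℕ → ℝ) (lam : ℕ → ℝ) : Prop :=
  ∃ D : ℝ≥0, ∀ k,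
    ENNReal.ofReal (lam k) * ∫⁻ x, ENNReal.ofReal (frobeniusNormSq (fderiv ℝ (u (t k)) x)) ≤ D

omit [FiniteDimensional ℝ E] [MeasurableSpace E] [BorelSpace E] in
/-- The space gradient of the final-time core slice: `D_y V(0, ·)(y) = c² • D u(t₀)(x₀ + c y)`
(chain rule; no differentiability needed, both sides being junk `0` together). [folklore] -/
theorem fderiv_coreProfile_zero (u : ℝ → E → E) (t₀ : ℝ) (x₀ : E) (c : ℝ) (y : E) :
    fderiv ℝ (coreProfile u t₀ x₀ c 0) y = c ^ 2 • fderiv ℝ (u t₀) (x₀ + c • y) := by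
  have h1 : coreProfile u t₀ x₀ c 0 = c • stPull (c ^ 2) c t₀ x₀ u 0 := rfl
  rw [h1, fderiv_const_smul_field, Pi.smul_apply, fderiv_stPull, smul_smul, mul_zero, add_zero, sq]

/-- **Dirichlet scaling identity for the core slice**: `∫ |∇_y V(0, y)|² dy =
c⁴ (cⁿ)⁻¹ ∫ |∇u(t₀, x)|² dx`, `n = dim E`, `0 < c` (`|c² L|² = c⁴ |L|²` and `dy = c⁻ⁿ dx` under
`x = x₀ + c y`; the Dirichlet integral is NOT scale invariant). [folklore] -/
theorem lintegral_frobeniusNormSq_fderiv_coreProfile_zero (u : ℝ → E → E) (t₀ : ℝ) (x₀ : E)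
    {c : ℝ} (hc : 0 < c) :
    ∫⁻ y, ENNReal.ofReal (frobeniusNormSq (fderiv ℝ (coreProfile u t₀ x₀ c 0) y)) =
      ENNReal.ofReal (c ^ 4 * (c ^ Module.finrank ℝ E)⁻¹) *
        ∫⁻ x, ENNReal.ofReal (frobeniusNormSq (fderiv ℝ (u t₀) x)) := by
  have h1 : ∀ y, ENNReal.ofReal (frobeniusNormSq (fderiv ℝ (coreProfile u t₀ x₀ c 0) y)) =
      ENNReal.ofReal (c ^ 4) *
        ENNReal.ofReal (frobeniusNormSq (fderiv ℝ (u t₀) (x₀ + c • y))) := fun y => by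
    rw [fderiv_coreProfile_zero, frobeniusNormSq_smul, ← ENNReal.ofReal_mul (by positivity)]
    ring_nf
  simp_rw [h1]
  rw [lintegral_const_mul' _ _ ENNReal.ofReal_ne_top,
    lintegral_comp_space_affine hc x₀ (fun x => ENNReal.ofReal (frobeniusNormSq (fderiv ℝ (u t₀) x))),
    ← mul_assoc, ← ENNReal.ofReal_mul (by positivity)]

/-- In dimension three the factor is `c`: `∫ |∇_y V(0, y)|² dy = c ∫ |∇u(t₀, x)|² dx`. [folklore] -/
theorem lintegral_frobeniusNormSq_fderiv_coreProfile_zero_three (hE : Module.finrank ℝ E = 3)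
    (u : ℝ → E → E) (t₀ : ℝ) (x₀ : E) {c : ℝ} (hc : 0 < c) :
    ∫⁻ y, ENNReal.ofReal (frobeniusNormSq (fderiv ℝ (coreProfile u t₀ x₀ c 0) y)) =
      ENNReal.ofReal c * ∫⁻ x, ENNReal.ofReal (frobeniusNormSq (fderiv ℝ (u t₀) x)) := by
  rw [lintegral_frobeniusNormSq_fderiv_coreProfile_zero u t₀ x₀ hc, hE]
  congr 2
  field_simp

/-- **The Dirichlet share in core variables** (dimension three): `HasBoundedDirichletShare u t lam`
iff the Dirichlet integrals `∫ |∇_y V_k(0, y)|² dy` of the core slices are bounded uniformly in `k`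
(any centres `ξ_k`, scales `λ_k > 0`). [folklore] -/
theorem hasBoundedDirichletShare_iff_core (hE : Module.finrank ℝ E = 3) {u : ℝ → E → E}
    {t : ℕ → ℝ} {lam : ℕ → ℝ} (ξ : ℕ → E) (hlam : ∀ k, 0 < lam k) :
    HasBoundedDirichletShare u t lam ↔ ∃ D : ℝ≥0, ∀ k,
      ∫⁻ y, ENNReal.ofReal (frobeniusNormSq (fderiv ℝ (coreProfile u (t k) (ξ k) (lam k) 0) y)) ≤ D := by
  simp only [HasBoundedDirichletShare,
    lintegral_frobeniusNormSq_fderiv_coreProfile_zero_three hE u _ _ (hlam _)]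

/-- The `ℝ³` instance of `hasBoundedDirichletShare_iff_core`. [folklore] -/
theorem hasBoundedDirichletShare_iff_core_fin3
    {u : ℝ → EuclideanSpace ℝ (Fin 3) → EuclideanSpace ℝ (Fin 3)} {t : ℕ → ℝ} {lam : ℕ → ℝ}
    (ξ : ℕ → EuclideanSpace ℝ (Fin 3)) (hlam : ∀ k, 0 < lam k) :
    HasBoundedDirichletShare u t lam ↔ ∃ D : ℝ≥0, ∀ k,
      ∫⁻ y, ENNReal.ofReal (frobeniusNormSq (fderiv ℝ (coreProfile u (t k) (ξ k) (lam k) 0) y)) ≤ D :=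
  hasBoundedDirichletShare_iff_core finrank_euclideanSpace_fin ξ hlam

/-- A quasi-steady core sequence has positive scales, so its Dirichlet share reads in core
variables (dimension three). [folklore] -/
theorem IsQuasiSteadyCoreSequence.hasBoundedDirichletShare_iff (hE : Module.finrank ℝ E = 3)
    {ν T M : ℝ} {u : ℝ → E → E} {t : ℕ → ℝ} {ξ : ℕ → E} {lam : ℕ → ℝ}
    (h : IsQuasiSteadyCoreSequence ν T u t ξ lam M) :
    HasBoundedDirichletShare u t lam ↔ ∃ D : ℝ≥0, ∀ k,
      ∫⁻ y, ENNReal.ofReal (frobeniusNormSq (fderiv ℝ (coreProfile u (t k) (ξ k) (lam k) 0) y)) ≤ D :=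
  hasBoundedDirichletShare_iff_core hE ξ h.scale_pos

end Dirichlet

/-! ### Extraction of a `C²` core limit (Arzelà–Ascoli and Landau's inequality) -/

section LandauUpgrade

variable {P : Type*} [NormedAddCommGroup P] [NormedSpace ℝ P]
variable {G : Type*} [NormedAddCommGroup G] [NormedSpace ℝ G]

/-- `‖D(Df)(y)‖ = ‖D²f(y)‖` (the currying isometries; unconditional). A `private` copy of the
tree's `norm_fderiv_fderiv_eq_norm_iteratedFDeriv_two` (`KNSSThm52Assembly`, not imported here to
keep the import cone small). [folklore] -/
private theorem norm_fderiv_fderiv_eq_norm_iteratedFDeriv_two' (f : P → G) (y : P) :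
    ‖fderiv ℝ (fderiv ℝ f) y‖ = ‖iteratedFDeriv ℝ 2 f y‖ := by
  rw [← norm_iteratedFDeriv_fderiv, norm_iteratedFDeriv_one]

/-- Differences of second derivatives are controlled by differences of the second Taylor
coefficients: `‖D(Df)(z) - D(Df)(y)‖ ≤ ‖D²f(z) - D²f(y)‖` (`D²f(x)(v, w) = D(Df)(x) v w`,
`iteratedFDeriv_two_apply`). [folklore] -/
theorem norm_fderiv_fderiv_sub_le (f : P → G) (z y : P) :
    ‖fderiv ℝ (fderiv ℝ f) z - fderiv ℝ (fderiv ℝ f) y‖ ≤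
      ‖iteratedFDeriv ℝ 2 f z - iteratedFDeriv ℝ 2 f y‖ := by
  refine ContinuousLinearMap.opNorm_le_bound₂ _ (norm_nonneg _) fun v w => ?_
  have h := (iteratedFDeriv ℝ 2 f z - iteratedFDeriv ℝ 2 f y).le_opNorm ![v, w]
  rw [Fin.prod_univ_two] at h
  have e : (iteratedFDeriv ℝ 2 f z - iteratedFDeriv ℝ 2 f y) ![v, w] =
      (fderiv ℝ (fderiv ℝ f) z - fderiv ℝ (fderiv ℝ f) y) v w := by
    simp [iteratedFDeriv_two_apply]
  rw [e] at h
  simpa only [Matrix.cons_val_zero, Matrix.cons_val_one, Matrix.head_cons, mul_assoc] using h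

/-- **Uniformly Cauchy functions with equi-Lipschitz first derivatives have uniformly Cauchy first
derivatives** (Landau's interpolation inequality `‖DF(p)‖ ≤ 2 sup‖F‖/s + s Lip(DF)` applied to the
differences `F = F_j - F_{j'}`; Dieudonné (8.6.3)): if for all large `j` the `F j` are
differentiable on `ball p (R + 1)` with `D(F j)` `C`-Lipschitz there, and `(F j)` is uniformly
Cauchy on `ball p (R + 1)`, then `(D(F j))` is uniformly Cauchy on `ball p R`. [folklore] -/
theorem uniformCauchySeqOn_fderiv_of_lipschitz {F : ℕ → P → G} {p : P} {R C : ℝ}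
    (hF : ∀ᶠ j in atTop, ∀ y ∈ ball p (R + 1), DifferentiableAt ℝ (F j) y ∧
      ∀ z ∈ ball p (R + 1), ‖fderiv ℝ (F j) z - fderiv ℝ (F j) y‖ ≤ C * ‖z - y‖)
    (h0 : UniformCauchySeqOn F atTop (ball p (R + 1))) :
    UniformCauchySeqOn (fun j => fderiv ℝ (F j)) atTop (ball p R) := by
  set C' : ℝ := max C 0 with hC'
  have hC'0 : 0 ≤ C' := le_max_right _ _
  refine Metric.uniformCauchySeqOn_iff.2 fun ε hε => ?_
  -- Landau's parameters: radius `s` with `2 C' s ≤ ε / 2`, then smallness `η = ε s / 8`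
  set s : ℝ := min (1 / 2) (ε / (4 * (2 * C' + 1))) with hs_def
  have hs0 : 0 < s := lt_min (by norm_num) (by positivity)
  have hs1 : s < 1 := (min_le_left _ _).trans_lt (by norm_num)
  have hsC : s * (2 * C') ≤ ε / 2 := by
    calc s * (2 * C') ≤ ε / (4 * (2 * C' + 1)) * (2 * C') :=
          mul_le_mul_of_nonneg_right (min_le_right _ _) (by positivity)
      _ ≤ ε / (4 * (2 * C' + 1)) * (2 * (2 * C' + 1)) := by gcongr; linarith
      _ = ε / 2 := by field_simp; ring
  set η : ℝ := ε * s / 8 with hη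
  have hη0 : 0 < η := by positivity
  have hηs : 2 * η / s = ε / 4 := by
    rw [hη]; field_simp; ring
  obtain ⟨N₁, hN₁⟩ := Metric.uniformCauchySeqOn_iff.1 h0 η hη0
  obtain ⟨N₂, hN₂⟩ := eventually_atTop.1 hF
  refine ⟨max N₁ N₂, fun j hj j' hj' y hy => ?_⟩
  have hjF := hN₂ j (le_of_max_le_right hj)
  have hj'F := hN₂ j' (le_of_max_le_right hj')
  -- the difference `D = F j - F j'` on the unit ball around `y`
  set D : P → G := fun z => F j z - F j' z with hD
  have hsub : ball y 1 ⊆ ball p (R + 1) := by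
    intro z hz
    rw [mem_ball] at hz hy ⊢
    calc dist z p ≤ dist z y + dist y p := dist_triangle _ _ _
      _ < 1 + R := add_lt_add hz hy
      _ = R + 1 := add_comm _ _
  have hyB : y ∈ ball p (R + 1) := hsub (mem_ball_self one_pos)
  have hDd : ∀ z ∈ ball p (R + 1), DifferentiableAt ℝ D z := fun z hz =>
    (hjF z hz).1.sub (hj'F z hz).1
  have hDf : ∀ z ∈ ball p (R + 1), fderiv ℝ D z = fderiv ℝ (F j) z - fderiv ℝ (F j') z :=
    fun z hz => fderiv_sub (hjF z hz).1 (hj'F z hz).1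
  have hD0 : ∀ z ∈ ball y 1, ‖D z‖ ≤ η := fun z hz => by
    have := hN₁ j (le_of_max_le_left hj) j' (le_of_max_le_left hj') z (hsub hz)
    rw [dist_eq_norm] at this
    exact this.le
  have hlipC' : ∀ {k : ℕ}, (∀ y ∈ ball p (R + 1), DifferentiableAt ℝ (F k) y ∧
      ∀ z ∈ ball p (R + 1), ‖fderiv ℝ (F k) z - fderiv ℝ (F k) y‖ ≤ C * ‖z - y‖) →
      ∀ z ∈ ball y 1, ‖fderiv ℝ (F k) z - fderiv ℝ (F k) y‖ ≤ C' * ‖z - y‖ :=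
    fun hk z hz => ((hk y hyB).2 z (hsub hz)).trans
      (mul_le_mul_of_nonneg_right (le_max_left _ _) (norm_nonneg _))
  have hD2 : ∀ z ∈ ball y 1, ‖fderiv ℝ D z - fderiv ℝ D y‖ ≤ 2 * C' * ‖z - y‖ := by
    intro z hz
    rw [hDf z (hsub hz), hDf y hyB]
    have e : fderiv ℝ (F j) z - fderiv ℝ (F j') z - (fderiv ℝ (F j) y - fderiv ℝ (F j') y) =
        (fderiv ℝ (F j) z - fderiv ℝ (F j) y) - (fderiv ℝ (F j') z - fderiv ℝ (F j') y) := by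
      abel
    rw [e, two_mul, add_mul]
    exact (norm_sub_le _ _).trans (add_le_add (hlipC' hjF z hz) (hlipC' hj'F z hz))
  have key := Calculus.norm_fderiv_le_of_norm_le_of_lipschitz (fun z hz => hDd z (hsub hz)) hD0
    (by positivity) hD2 hs0 hs1
  rw [dist_eq_norm, ← hDf y hyB]
  calc ‖fderiv ℝ D y‖ ≤ 2 * η / s + s * (2 * C') := key
    _ = ε / 4 + s * (2 * C') := by rw [hηs]
    _ ≤ ε / 4 + ε / 2 := by linarith
    _ < ε := by linarith

omit [NormedSpace ℝ P] in
/-- A sequence which is uniformly Cauchy on every ball `ball 0 (n + 1)` of a normed group, with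
values in a complete space, converges uniformly on each of these balls to one limit map. [folklore] -/
theorem exists_tendstoUniformlyOn_of_uniformCauchySeqOn_ball {Y : Type*} [UniformSpace Y]
    [CompleteSpace Y] {F : ℕ → P → Y}
    (h : ∀ n : ℕ, UniformCauchySeqOn F atTop (ball (0 : P) ((n : ℝ) + 1))) :
    ∃ W : P → Y, ∀ n : ℕ, TendstoUniformlyOn F W atTop (ball (0 : P) ((n : ℝ) + 1)) := by
  have hpt : ∀ y : P, CauchySeq fun j => F j y := fun y => by
    obtain ⟨n, hn⟩ := exists_nat_gt ‖y‖
    exact (h n).cauchySeq (by rw [mem_ball_zero_iff]; linarith)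
  choose W hW using fun y => cauchySeq_tendsto_of_complete (hpt y)
  exact ⟨W, fun n => (h n).tendstoUniformlyOn_of_tendsto fun y _ => hW y⟩

/-- **The derivative of the limit is the limit of the derivatives**, local and eventual form
(Mathlib's `hasFDerivAt_of_tendstoUniformlyOnFilter`): if eventually the `F j` are differentiable
on `ball p r`, `F j → g` pointwise there and `D(F j) → W` uniformly there, then `g` has derivative
`W y` at every `y ∈ ball p r`. [folklore] -/
theorem hasFDerivAt_of_tendstoUniformlyOn_ball {F : ℕ → P → G} {g : P → G} {W : P → P →L[ℝ] G}
    {p : P} {r : ℝ} (hF : ∀ᶠ j in atTop, ∀ z ∈ ball p r, DifferentiableAt ℝ (F j) z)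
    (hg : ∀ z ∈ ball p r, Tendsto (fun j => F j z) atTop (𝓝 (g z)))
    (hW : TendstoUniformlyOn (fun j => fderiv ℝ (F j)) W atTop (ball p r)) {y : P}
    (hy : y ∈ ball p r) : HasFDerivAt g (W y) y := by
  have hball : ball p r ∈ 𝓝 y := isOpen_ball.mem_nhds hy
  refine hasFDerivAt_of_tendstoUniformlyOnFilter (l := (atTop : Filter ℕ)) (f := F)
    (f' := fun j => fderiv ℝ (F j)) ?_ ?_ ?_
  · exact (tendstoUniformlyOn_iff_tendstoUniformlyOnFilter.1 hW).mono_right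
      (le_principal_iff.2 hball)
  · filter_upwards [hF.prod_mk (show ∀ᶠ z in 𝓝 y, z ∈ ball p r from hball)] with q hq
    exact (hq.1 q.2 hq.2).hasFDerivAt
  · filter_upwards [hball] with z hz using hg z hz

end LandauUpgrade

section Extraction

variable {E : Type*} [NormedAddCommGroup E] [InnerProductSpace ℝ E]
variable {F : Type*} [NormedAddCommGroup F] [NormedSpace ℝ F]

/-- A space–time field which is `Cⁿ` at `(s, y)` has a `Cⁿ` space slice at `y`. [folklore] -/
theorem contDiffAt_slice_space {n : WithTop ℕ∞} {W : ℝ → E → F} {s : ℝ} {y : E}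
    (h : ContDiffAt ℝ n (uncurry W) (s, y)) : ContDiffAt ℝ n (W s) y :=
  h.comp y (contDiffAt_const.prodMk contDiffAt_id)

/-- A space–time field which is `Cⁿ` at `(s, y)` has a `Cⁿ` time line at `s`. [folklore] -/
theorem contDiffAt_slice_time {n : WithTop ℕ∞} {W : ℝ → E → F} {s : ℝ} {y : E}
    (h : ContDiffAt ℝ n (uncurry W) (s, y)) : ContDiffAt ℝ n (fun σ => W σ y) s :=
  h.comp s (contDiffAt_id.prodMk contDiffAt_const)

/-- The time line of a space–time field which is `C¹` at `(s, y)` has derivative `timeDeriv W s y`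
there (so the `timeDeriv` in field (b) of `IsQuasiSteadyCoreSequence` is the true derivative under
field (a)). [folklore] -/
theorem hasDerivAt_timeDeriv_of_contDiffAt {n : WithTop ℕ∞} {W : ℝ → E → F} {s : ℝ} {y : E}
    (h : ContDiffAt ℝ n (uncurry W) (s, y)) (hn : n ≠ 0) :
    HasDerivAt (fun σ => W σ y) (timeDeriv W s y) s := by
  rw [timeDeriv_apply]
  exact ((contDiffAt_slice_time h).differentiableAt hn).hasDerivAt

variable [FiniteDimensional ℝ E]

namespace IsQuasiSteadyCoreSequence

variable {ν T M : ℝ} {u : ℝ → E → E} {t : ℕ → ℝ} {ξ : ℕ → E} {lam : ℕ → ℝ}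

/-- **Extraction of a `C²` core limit.** For a quasi-steady core sequence there are a subsequence
`φ` and a `C²` field `U : E → E` with `‖U 0‖ = 1`, `‖U‖ ≤ M ν`, such that the final-time core
slices `V_{φ j}(0, ·)` converge to `U` uniformly on every ball TOGETHER WITH THEIR FIRST AND SECOND
SPACE DERIVATIVES (`C²_loc` convergence), and — by quasi-steadiness (b) — the space–time fields
`V_{φ j}` converge to the `s`-INDEPENDENT field `(s, y) ↦ U y` uniformly on every parabolic window
`[-A, 0] × B̄(0, A)`. (Arzelà–Ascoli on the balls `B̄(0, n+1)` along one diagonal subsequence, with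
the Lipschitz moduli given by (a); Landau's inequality upgrades the uniform convergence to the first
two derivatives using the bounds of orders two and three; the derivative of the limit is the limit
of the derivatives. This is the compactness step of a frozen-core argument: KNSS 2009, Lemma 6.1,
in the `C²` topology and at the final time.) [folklore] -/
theorem exists_strictMono_tendstoUniformlyOn (h : IsQuasiSteadyCoreSequence ν T u t ξ lam M) :
    ∃ φ : ℕ → ℕ, StrictMono φ ∧ ∃ U : E → E, ContDiff ℝ 2 U ∧ ‖U 0‖ = 1 ∧ (∀ y, ‖U y‖ ≤ M * ν) ∧
      (∀ A : ℝ, TendstoUniformlyOn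
        (fun j => coreProfile u (t (φ j)) (ξ (φ j)) (lam (φ j)) 0) U atTop (closedBall 0 A)) ∧
      (∀ A : ℝ, TendstoUniformlyOn
        (fun j => fderiv ℝ (coreProfile u (t (φ j)) (ξ (φ j)) (lam (φ j)) 0)) (fderiv ℝ U) atTop
        (closedBall 0 A)) ∧
      (∀ A : ℝ, TendstoUniformlyOn
        (fun j => fderiv ℝ (fderiv ℝ (coreProfile u (t (φ j)) (ξ (φ j)) (lam (φ j)) 0)))
        (fderiv ℝ (fderiv ℝ U)) atTop (closedBall 0 A)) ∧
      (∀ A : ℝ, TendstoUniformlyOn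
        (fun j => uncurry (coreProfile u (t (φ j)) (ξ (φ j)) (lam (φ j))))
        (fun z => U z.2) atTop (Icc (-A) 0 ×ˢ closedBall 0 A)) := by
  -- the core profiles and hypothesis (a) on the windows `A = n + 1`
  set V : ℕ → ℝ → E → E := fun k => coreProfile u (t k) (ξ k) (lam k) with hV
  have ha : ∀ n : ℕ, ∃ C : ℝ, ∀ᶠ k in atTop, ∀ s ∈ Icc (-((n : ℝ) + 1)) 0,
      ∀ y ∈ closedBall (0 : E) ((n : ℝ) + 1),
        ContDiffAt ℝ 3 (uncurry (V k)) (s, y) ∧ ∀ m ≤ 3, ‖iteratedFDeriv ℝ m (V k s) y‖ ≤ C :=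
    fun n => h.core_bound _ (by positivity)
  choose C hC using ha
  have h0mem : ∀ n : ℕ, (0 : ℝ) ∈ Icc (-((n : ℝ) + 1)) 0 := fun n =>
    ⟨by have : (0 : ℝ) ≤ n := n.cast_nonneg; linarith, le_rfl⟩
  -- consequences of (a) for the final-time slices
  have hslice : ∀ n : ℕ, ∀ᶠ k in atTop, ∀ y ∈ closedBall (0 : E) ((n : ℝ) + 1),
      ContDiffAt ℝ 3 (V k 0) y ∧ ‖V k 0 y‖ ≤ C n ∧ ‖fderiv ℝ (V k 0) y‖ ≤ C n ∧
        ‖fderiv ℝ (fderiv ℝ (V k 0)) y‖ ≤ C n ∧ ‖iteratedFDeriv ℝ 3 (V k 0) y‖ ≤ C n := by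
    intro n
    filter_upwards [hC n] with k hk y hy
    obtain ⟨hreg, hbd⟩ := hk 0 (h0mem n) y hy
    refine ⟨contDiffAt_slice_space hreg, ?_, ?_, ?_, hbd 3 le_rfl⟩
    · simpa using hbd 0 (by norm_num)
    · simpa using hbd 1 (by norm_num)
    · rw [norm_fderiv_fderiv_eq_norm_iteratedFDeriv_two']; exact hbd 2 (by norm_num)
  -- differentiability of the slices and of their first two derivatives
  have hdiff : ∀ {g : E → E} {y : E}, ContDiffAt ℝ 3 g y →
      DifferentiableAt ℝ g y ∧ DifferentiableAt ℝ (fderiv ℝ g) y ∧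
        ContDiffAt ℝ 1 (fderiv ℝ (fderiv ℝ g)) y ∧ DifferentiableAt ℝ (iteratedFDeriv ℝ 2 g) y := by
    intro g y hg
    have h2 : ContDiffAt ℝ 2 (fderiv ℝ g) y := hg.fderiv_right (by norm_num)
    exact ⟨hg.differentiableAt (by norm_num), h2.differentiableAt (by norm_num),
      h2.fderiv_right (by norm_num), hg.differentiableAt_iteratedFDeriv (by norm_num)⟩
  -- Step 1: Arzelà–Ascoli for the slices on the balls `B̄(0, n+1)`
  have hT : ∀ n : ℕ, IsCompact (closedBall (0 : E) ((n : ℝ) + 1)) := fun n =>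
    isCompact_closedBall _ _
  obtain ⟨φ, hφ, U, hU⟩ := exists_strictMono_tendstoUniformlyOn_of_bound (Y := E) hT
    (V := fun k => V k 0) (R := C) (K := fun n => max (C n) 0) (α := fun _ => 1)
    (fun n => le_max_right _ _) (fun _ => one_pos) (fun n => by
      filter_upwards [hslice n] with k hk
      refine ⟨fun y hy => (hk y hy).1.continuousAt.continuousWithinAt, fun y hy => (hk y hy).2.1,
        fun y hy y' hy' => ?_⟩
      rw [Real.rpow_one, dist_eq_norm, dist_eq_norm]
      exact (convex_closedBall (0 : E) ((n : ℝ) + 1)).norm_image_sub_le_of_norm_fderiv_le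
        (fun z hz => (hdiff (hk z hz).1).1)
        (fun z hz => ((hk z hz).2.2.1).trans (le_max_left _ _)) hy' hy)
  have hφt : Tendsto φ atTop atTop := hφ.tendsto_atTop
  -- the extracted slices, and (a) along the subsequence, on the open balls `B(0, n+1)`
  set f : ℕ → E → E := fun j => V (φ j) 0 with hf
  have hfU : ∀ n : ℕ, TendstoUniformlyOn f U atTop (closedBall (0 : E) ((n : ℝ) + 1)) := hU
  have hpack : ∀ n : ℕ, ∀ᶠ j in atTop, ∀ y ∈ ball (0 : E) ((n : ℝ) + 1),
      DifferentiableAt ℝ (f j) y ∧ DifferentiableAt ℝ (fderiv ℝ (f j)) y ∧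
        ContDiffAt ℝ 1 (fderiv ℝ (fderiv ℝ (f j))) y ∧
        (∀ z ∈ ball (0 : E) ((n : ℝ) + 1),
          ‖fderiv ℝ (f j) z - fderiv ℝ (f j) y‖ ≤ C n * ‖z - y‖) ∧
        ∀ z ∈ ball (0 : E) ((n : ℝ) + 1),
          ‖fderiv ℝ (fderiv ℝ (f j)) z - fderiv ℝ (fderiv ℝ (f j)) y‖ ≤ C n * ‖z - y‖ := by
    intro n
    filter_upwards [hφt.eventually (hslice n)] with j hj y hy
    have hj' : ∀ z ∈ ball (0 : E) ((n : ℝ) + 1), ContDiffAt ℝ 3 (f j) z ∧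
        ‖fderiv ℝ (fderiv ℝ (f j)) z‖ ≤ C n ∧ ‖iteratedFDeriv ℝ 3 (f j) z‖ ≤ C n := fun z hz =>
      ⟨(hj z (ball_subset_closedBall hz)).1, (hj z (ball_subset_closedBall hz)).2.2.2.1,
        (hj z (ball_subset_closedBall hz)).2.2.2.2⟩
    obtain ⟨hd0, hd1, hc2, hd2⟩ := hdiff (hj' y hy).1
    refine ⟨hd0, hd1, hc2, fun z hz => ?_, fun z hz => ?_⟩
    · exact (convex_ball (0 : E) ((n : ℝ) + 1)).norm_image_sub_le_of_norm_fderiv_le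
        (fun w hw => (hdiff (hj' w hw).1).2.1) (fun w hw => (hj' w hw).2.1) hy hz
    · refine (norm_fderiv_fderiv_sub_le (f j) z y).trans ?_
      exact (convex_ball (0 : E) ((n : ℝ) + 1)).norm_image_sub_le_of_norm_fderiv_le
        (fun w hw => (hdiff (hj' w hw).1).2.2.2)
        (fun w hw => by rw [norm_fderiv_iteratedFDeriv]; exact (hj' w hw).2.2) hy hz
  have hcast : ∀ n : ℕ, ((n : ℝ) + 1) + 1 = ((n + 1 : ℕ) : ℝ) + 1 := fun n => by push_cast; ring
  -- pointwise convergence of the slices everywhere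
  have hfpt : ∀ y : E, Tendsto (fun j => f j y) atTop (𝓝 (U y)) := fun y => by
    obtain ⟨n, hn⟩ := exists_nat_gt ‖y‖
    exact (hfU n).tendsto_at (by rw [mem_closedBall_zero_iff]; linarith)
  -- Step 2: the first derivatives are uniformly Cauchy on balls, hence converge, to `DU`
  have hC1 : ∀ n : ℕ, UniformCauchySeqOn (fun j => fderiv ℝ (f j)) atTop
      (ball (0 : E) ((n : ℝ) + 1)) := by
    intro n
    refine uniformCauchySeqOn_fderiv_of_lipschitz (C := C (n + 1)) ?_ ?_
    · rw [hcast]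
      filter_upwards [hpack (n + 1)] with j hj y hy
      exact ⟨(hj y hy).1, (hj y hy).2.2.2.1⟩
    · rw [hcast]
      exact ((hfU (n + 1)).mono ball_subset_closedBall).uniformCauchySeqOn
  obtain ⟨W₁, hW₁⟩ := exists_tendstoUniformlyOn_of_uniformCauchySeqOn_ball hC1
  have hUW₁ : ∀ y : E, HasFDerivAt U (W₁ y) y := fun y => by
    obtain ⟨n, hn⟩ := exists_nat_gt ‖y‖
    refine hasFDerivAt_of_tendstoUniformlyOn_ball ?_ (fun z _ => hfpt z) (hW₁ n)
      (by rw [mem_ball_zero_iff]; linarith)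
    filter_upwards [hpack n] with j hj z hz using (hj z hz).1
  have hfdU : fderiv ℝ U = W₁ := funext fun y => (hUW₁ y).fderiv
  -- Step 3: the same for the second derivatives
  have hW₁pt : ∀ y : E, Tendsto (fun j => fderiv ℝ (f j) y) atTop (𝓝 (W₁ y)) := fun y => by
    obtain ⟨n, hn⟩ := exists_nat_gt ‖y‖
    exact (hW₁ n).tendsto_at (by rw [mem_ball_zero_iff]; linarith)
  have hC2 : ∀ n : ℕ, UniformCauchySeqOn (fun j => fderiv ℝ (fderiv ℝ (f j))) atTop
      (ball (0 : E) ((n : ℝ) + 1)) := by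
    intro n
    refine uniformCauchySeqOn_fderiv_of_lipschitz (F := fun j => fderiv ℝ (f j))
      (C := C (n + 1)) ?_ ?_
    · rw [hcast]
      filter_upwards [hpack (n + 1)] with j hj y hy
      exact ⟨(hj y hy).2.1, (hj y hy).2.2.2.2⟩
    · rw [hcast]
      exact hC1 (n + 1)
  obtain ⟨W₂, hW₂⟩ := exists_tendstoUniformlyOn_of_uniformCauchySeqOn_ball hC2
  have hW₁W₂ : ∀ y : E, HasFDerivAt W₁ (W₂ y) y := fun y => by
    obtain ⟨n, hn⟩ := exists_nat_gt ‖y‖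
    refine hasFDerivAt_of_tendstoUniformlyOn_ball ?_ (fun z _ => hW₁pt z) (hW₂ n)
      (by rw [mem_ball_zero_iff]; linarith)
    filter_upwards [hpack n] with j hj z hz using (hj z hz).2.1
  have hfdW₁ : fderiv ℝ W₁ = W₂ := funext fun y => (hW₁W₂ y).fderiv
  -- Step 4: `U` is `C²`
  have hW₂c : Continuous W₂ := by
    refine continuous_iff_continuousAt.2 fun y => ?_
    obtain ⟨n, hn⟩ := exists_nat_gt ‖y‖
    have hyb : y ∈ ball (0 : E) ((n : ℝ) + 1) := by rw [mem_ball_zero_iff]; linarith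
    refine ((hW₂ n).continuousOn ?_).continuousAt (isOpen_ball.mem_nhds hyb)
    refine Eventually.frequently ?_
    filter_upwards [hpack n] with j hj
    exact fun z hz => (hj z hz).2.2.1.continuousAt.continuousWithinAt
  have hW₁C : ContDiff ℝ 1 W₁ := contDiff_one_iff_hasFDerivAt.2 ⟨W₂, hW₂c, hW₁W₂⟩
  have hUC : ContDiff ℝ 2 U := by
    have h2 : ContDiff ℝ ((1 : ℕ) + 1) U := contDiff_succ_iff_hasFDerivAt.2 ⟨W₁, hW₁C, hUW₁⟩
    have e : ((1 : ℕ) : WithTop ℕ∞) + 1 = 2 := by norm_num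
    rwa [e] at h2
  -- Step 5: the normalisation and the bound pass to the limit
  have hU0 : ‖U 0‖ = 1 := by
    have h1 : Tendsto (fun j => ‖f j 0‖) atTop (𝓝 ‖U 0‖) := (hfpt 0).norm
    have h2 : (fun j => ‖f j 0‖) = fun _ => (1 : ℝ) := funext fun j =>
      h.norm_coreProfile_zero_zero (φ j)
    rw [h2] at h1
    exact tendsto_nhds_unique h1 tendsto_const_nhds
  have hUb : ∀ y, ‖U y‖ ≤ M * ν := fun y =>
    le_of_tendsto' (hfpt y).norm fun j => h.norm_coreProfile_zero_le (φ j) y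
  -- conclusions on arbitrary closed balls
  have hball : ∀ A : ℝ, ∃ n : ℕ, closedBall (0 : E) A ⊆ ball (0 : E) ((n : ℝ) + 1) ∧
      closedBall (0 : E) A ⊆ closedBall (0 : E) ((n : ℝ) + 1) := fun A => by
    obtain ⟨n, hn⟩ := exists_nat_gt A
    have h1 : closedBall (0 : E) A ⊆ ball (0 : E) ((n : ℝ) + 1) :=
      closedBall_subset_ball (by linarith)
    exact ⟨n, h1, h1.trans ball_subset_closedBall⟩
  refine ⟨φ, hφ, U, hUC, hU0, hUb, fun A => ?_, fun A => ?_, fun A => ?_, fun A => ?_⟩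
  · obtain ⟨n, -, hn⟩ := hball A
    exact (hfU n).mono hn
  · obtain ⟨n, hn, -⟩ := hball A
    rw [hfdU]
    exact (hW₁ n).mono hn
  · obtain ⟨n, hn, -⟩ := hball A
    rw [hfdU, hfdW₁]
    exact (hW₂ n).mono hn
  · -- Step 6: quasi-steadiness (b) makes the space–time limit `s`-independent
    obtain ⟨n, -, hn⟩ := hball A
    refine Metric.tendstoUniformlyOn_iff.2 fun ε hε => ?_
    have hA1 : 0 < |A| + 1 := by positivity
    set δ : ℝ := ε / (2 * (|A| + 1)) with hδ
    have hδ0 : 0 < δ := by positivity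
    have hδA : δ * |A| < ε / 2 := by
      calc δ * |A| < δ * (|A| + 1) := by gcongr; exact lt_add_one _
        _ = ε / 2 := by rw [hδ]; field_simp
    have hb := hφt.eventually (h.quasiSteady (|A| + 1) hA1 δ hδ0)
    have ha' := hφt.eventually (h.core_bound (|A| + 1) hA1).choose_spec
    have h0 := Metric.tendstoUniformlyOn_iff.1 (hfU n) (ε / 2) (half_pos hε)
    filter_upwards [hb, ha', h0] with j hbj haj h0j z hz
    obtain ⟨hs, hy⟩ := mem_prod.1 hz
    have hIcc : Icc (-A) 0 ⊆ Icc (-(|A| + 1)) 0 :=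
      Icc_subset_Icc (by linarith [le_abs_self A]) le_rfl
    have hcb : closedBall (0 : E) A ⊆ closedBall 0 (|A| + 1) :=
      closedBall_subset_closedBall (by linarith [le_abs_self A])
    have h0I : (0 : ℝ) ∈ Icc (-(|A| + 1)) 0 := ⟨by linarith [abs_nonneg A], le_rfl⟩
    -- mean value in time on `[-(|A|+1), 0]`
    have hmvt : ‖V (φ j) 0 z.2 - V (φ j) z.1 z.2‖ ≤ δ * ‖(0 : ℝ) - z.1‖ :=
      (convex_Icc (-(|A| + 1)) 0).norm_image_sub_le_of_norm_deriv_le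
        (f := fun σ => V (φ j) σ z.2) (x := z.1) (y := 0)
        (fun σ hσ => (contDiffAt_slice_time (haj σ hσ z.2 (hcb hy)).1).differentiableAt
          (by norm_num))
        (fun σ hσ => hbj σ hσ z.2 (hcb hy)) (hIcc hs) h0I
    have hs' : ‖(0 : ℝ) - z.1‖ ≤ |A| := by
      rw [Real.norm_eq_abs, zero_sub, abs_neg, abs_of_nonpos hs.2]
      linarith [hs.1, le_abs_self A]
    have h1 : ‖V (φ j) 0 z.2 - V (φ j) z.1 z.2‖ < ε / 2 :=
      hmvt.trans_lt ((mul_le_mul_of_nonneg_left hs' hδ0.le).trans_lt hδA)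
    have h2 : dist (U z.2) (f j z.2) < ε / 2 := h0j z.2 (hn hy)
    calc dist (U z.2) (uncurry (V (φ j)) z)
        ≤ dist (U z.2) (f j z.2) + dist (f j z.2) (uncurry (V (φ j)) z) := dist_triangle _ _ _
      _ < ε / 2 + ε / 2 := add_lt_add h2 (by rw [dist_eq_norm]; exact h1)
      _ = ε := add_halves ε

end IsQuasiSteadyCoreSequence

end Extraction

end Literature.Analysis.FluidPDE

end
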